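import Mathlib.LinearAlgebra.Matrix.PosDef
import Mathlib.Data.Real.Star
import Mathlib.RingTheory.Trace.Basic
import Mathlib.NumberTheory.NumberField.InfinitePlace.TotallyRealComplex
import HarnessLib

/-!
# Trace-form ("restriction of scalars") semidefinite blocks — Hillar 2009, Scheiderer 2012

Topic `Literature/Computation/Certificates` (joins `SemidefiniteRigorousBounds.lean`,
`LagrangianSplitBound.lean`: kernel-checkable certificate arithmetic).

THE DEVICE. A semidefinite constraint `R ⪰ 0` whose matrix `R` has entries in a totally real number
field `K` of degree `d` (in the fleet: a first-moment / "f-sum" momentum block at a lattice momentum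
`q ∈ (2π/N)ℤ²`, entries in `ℚ(ζ_N) ∩ ℝ`, e.g. `ℚ(√2, √3)` for `N = 24`) is replaced by ONE rational
constraint: with the real embeddings `σ₁, …, σ_d` of `K` and a `ℚ`-basis `β₁, …, β_d`, the *trace form*
`G_{(j,a),(k,b)} := Tr_{K/ℚ}(β_j β_k R_{ab}) = Σ_i σ_i(β_j) σ_i(β_k) σ_i(R_{ab})` is a rational symmetric
`nd × nd` matrix, and

  `G ⪰ 0 ⟺ σ_i(R) ⪰ 0 for every i`.

Sources: C. J. Hillar, *Sums of squares over totally real fields are rational sums of squares*,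
Proc. Amer. Math. Soc. 137 (2009) 921–930 [Hillar2009TotallyRealSOS] — Theorem 2.1 (the Galois-averaged
sum of squares `Σ_σ (σp)²` is a rational sum of squares) and Remark 2.2 ("elements of the form
`Σ_σ (σp)²` are also sometimes called trace forms for the field extension `K`"); C. Scheiderer,
*Sums of squares of polynomials with rational coefficients*, arXiv:1209.2976 [Scheiderer2012RationalSOS] —
§1, 1.1 (the trace form `y ↦ tr_{K/k}(y²)` is positive definite when every ordering of `k` has `[K:k]`
extensions, i.e. for `K/ℚ` totally real; Scharlau, *Quadratic and Hermitian Forms*, Thm 3.4.5) and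
Question 5.4 (the notion "`A(x)` positive semidefinite with respect to every real place of `K`").
The matrix statement proved here is the linear-algebra core common to both ("restriction of scalars of
a symmetric bilinear form"); the number field enters only through the real matrix `E_{ij} = σ_i(β_j)`
(invertible: `det E² = disc(β) ≠ 0`) and through `Tr = Σ_i σ_i` (Mathlib `trace_eq_sum_embeddings`),
which identify `TraceForm.block E (fun i => σ_i(R))` with the rational matrix `G` above.

What is proved (everything over `ℝ`, finite index types):

* `TraceForm.block E R` — the block `G_{(j,a),(k,b)} = Σ_i E_{ij} E_{ik} (R i)_{ab}` for an arbitrary real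
  `ι × J` matrix `E` and a family `R : ι → Matrix n n ℝ` (the conjugate blocks);
* `TraceForm.block_eq_sum_conjTranspose_mul_mul` — `G = Σ_i P_iᵀ (R i) P_i` with the explicit
  `P_i = TraceForm.embed E i`;
* `TraceForm.posSemidef_block` — **soundness direction** (the one a relaxation needs: the rational block
  is IMPLIED by the conjugate blocks): `(∀ i, R i ⪰ 0) → G ⪰ 0`, for ANY `E` (no invertibility);
* `TraceForm.conjTranspose_select_mul_block_mul_select` — if `E` has a right inverse `F` (`E * F = 1`),
  then `Q_iᵀ G Q_i = R i` with the explicit `Q_i = TraceForm.select F i`;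
* `TraceForm.block_embeddings_apply`, `TraceForm.posSemidef_traceMatrix_of_forall_embeddings` — the
  number-field packaging of the soundness direction: for `K` totally real (Mathlib `IsTotallyReal`), the
  block built from the embeddings `τ : K →+* ℂ` IS the rational matrix `[Tr_{K/ℚ}(β_jβ_kR_{ab})]`, hence
  that matrix is PSD whenever `τ(R) ⪰ 0` for every `τ`;
* `TraceForm.posSemidef_of_block` — **tightness direction** (nothing is lost): `E * F = 1 → G ⪰ 0 → R i ⪰ 0`;
* `TraceForm.posSemidef_block_iff` — both together.

* `TraceForm.exists_embeddingMatrix_mul_eq_one`, `TraceForm.posSemidef_traceMatrix_iff` — the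
  number-field form of the TIGHTNESS direction: for a `ℚ`-BASIS `b` of a totally real `K` the real
  embedding matrix `(Re τ(b_j))` has a right inverse (its determinant squares to `discr ℚ b ≠ 0`,
  Mathlib `Algebra.discr_eq_det_embeddingsMatrixReindex_pow_two` + `Algebra.discr_not_zero_of_basis`),
  hence `[Tr_{K/ℚ}(b_j b_k R_{ab})] ⪰ 0 ⟺ τ(R) ⪰ 0` for every embedding `τ` (Scheiderer's "positive
  semidefinite with respect to every real place").

No `Prop` definitions, no named facts; everything is proved. Certificates need only the soundness
direction; the equivalence records that the rational block loses nothing.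
-/

namespace Literature.Computation.Certificates

open Matrix Finset

namespace TraceForm

variable {ι J n : Type*}

/-- The trace-form block of a family of "conjugate" matrices `R i` weighted by an embedding matrix `E`:
`G_{(j,a),(k,b)} = Σ_i E_{ij} E_{ik} (R i)_{ab}`. With `E_{ij} = σ_i(β_j)` and `R i = σ_i(R)` this is the
rational matrix `Tr_{K/ℚ}(β_j β_k R_{ab})`.
[cite: Hillar2009TotallyRealSOS, Theorem 2.1 and Remark 2.2] [cite: Scheiderer2012RationalSOS, §1.1] -/
def block [Fintype ι] (E : Matrix ι J ℝ) (R : ι → Matrix n n ℝ) : Matrix (J × n) (J × n) ℝ :=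
  Matrix.of fun p q => ∑ i, E i p.1 * E i q.1 * R i p.2 q.2

/-- Entries of the trace-form block: `G_{(j,a),(k,b)} = Σ_i E_{ij} E_{ik} (R i)_{ab}` (definition
unfolding; with `E_{ij} = σ_i(β_j)`, `R i = σ_i(R)` this is `Tr_{K/ℚ}(β_jβ_kR_{ab})`).
[cite: Hillar2009TotallyRealSOS, Remark 2.2] -/
@[simp] theorem block_apply [Fintype ι] (E : Matrix ι J ℝ) (R : ι → Matrix n n ℝ) (p q : J × n) :
    block E R p q = ∑ i, E i p.1 * E i q.1 * R i p.2 q.2 := rfl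

/-- The `i`-th embedding matrix `P_i : Matrix n (J × n) ℝ`, `(P_i)_{a,(j,b)} = E_{ij} [a = b]`
(so `P_i X = σ_i(x)` blockwise when `X` holds the `β`-coordinates of `x ∈ Kⁿ`). [folklore] -/
def embed [DecidableEq n] (E : Matrix ι J ℝ) (i : ι) : Matrix n (J × n) ℝ :=
  Matrix.of fun a q => if a = q.2 then E i q.1 else 0

/-- Entries of the `i`-th embedding matrix `P_i` (definition unfolding): `(P_i)_{a,(j,b)} = E_{ij}[a = b]`,
the matrix of `x ↦ σ_i(x)` in `β`-coordinates. [cite: Hillar2009TotallyRealSOS, Theorem 2.1 and Remark 2.2] -/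
@[simp] theorem embed_apply [DecidableEq n] (E : Matrix ι J ℝ) (i : ι) (a : n) (q : J × n) :
    embed E i a q = if a = q.2 then E i q.1 else 0 := rfl

/-- **`G = Σ_i P_iᵀ (R i) P_i`** — the trace form is a sum of congruences of the conjugate blocks
(Hillar's Galois averaging written for a Gram matrix).
[cite: Hillar2009TotallyRealSOS, Theorem 2.1 and Remark 2.2] -/
theorem block_eq_sum_conjTranspose_mul_mul [Fintype ι] [Fintype n] [DecidableEq n]
    (E : Matrix ι J ℝ) (R : ι → Matrix n n ℝ) :
    block E R = ∑ i, (embed E i)ᴴ * R i * embed E i := by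
  ext p q
  rw [block_apply, Matrix.sum_apply]
  refine Finset.sum_congr rfl fun i _ => ?_
  have h1 : ∀ b, ((embed E i)ᴴ * R i : Matrix (J × n) n ℝ) p b = E i p.1 * R i p.2 b := by
    intro b
    simp only [Matrix.mul_apply, conjTranspose_apply, embed_apply, star_trivial, ite_mul, zero_mul,
      Finset.sum_ite_eq', Finset.mem_univ, if_true]
  rw [Matrix.mul_apply]
  simp only [h1, embed_apply, mul_ite, mul_zero, Finset.sum_ite_eq', Finset.mem_univ, if_true]
  ring

/-- **Soundness direction: the trace-form block is implied by the conjugate blocks.** If every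
conjugate block `R i` is positive semidefinite, so is `G = TraceForm.block E R` — for ANY real matrix
`E` (this is `XᵀGX = Σ_i (P_iX)ᵀ (R i) (P_iX) ≥ 0`). In the fleet's use: a trace-form momentum block
`G(y) ⪰ 0` is a VALID constraint on every moment vector `y` for which all Galois-conjugate first-moment
blocks `M₁(u·q)(y) ⪰ 0` hold. [cite: Hillar2009TotallyRealSOS, Theorem 2.1 and Remark 2.2]
[cite: Scheiderer2012RationalSOS, §1.1] -/
theorem posSemidef_block [Fintype ι] [Fintype J] [Fintype n] [DecidableEq n] (E : Matrix ι J ℝ)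
    {R : ι → Matrix n n ℝ} (hR : ∀ i, (R i).PosSemidef) : (block E R).PosSemidef := by
  rw [block_eq_sum_conjTranspose_mul_mul]
  exact posSemidef_sum _ fun i _ => (hR i).conjTranspose_mul_mul_same _

/-- The selector `Q_{i₀} : Matrix (J × n) n ℝ`, `(Q_{i₀})_{(j,a),b} = F_{j i₀} [a = b]`, built from a
right inverse `F` of `E`. [folklore] -/
def select [DecidableEq n] (F : Matrix J ι ℝ) (i₀ : ι) : Matrix (J × n) n ℝ :=
  Matrix.of fun p b => if p.2 = b then F p.1 i₀ else 0

/-- Entries of the selector `Q_{i₀}` (definition unfolding): `(Q_{i₀})_{(j,a),b} = F_{j i₀}[a = b]` — the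
`i₀`-th column of the inverse embedding matrix, i.e. the coordinates realising the diagonalisation of the
trace form. [cite: Scheiderer2012RationalSOS, §1.1] -/
@[simp] theorem select_apply [DecidableEq n] (F : Matrix J ι ℝ) (i₀ : ι) (p : J × n) (b : n) :
    select F i₀ p b = if p.2 = b then F p.1 i₀ else 0 := rfl

/-- `P_i Q_{i₀} = (E F)_{i i₀} · 1`. [folklore] -/
private theorem embed_mul_select [Fintype J] [Fintype n] [DecidableEq n] (E : Matrix ι J ℝ) (F : Matrix J ι ℝ)
    (i i₀ : ι) : embed E i * select F i₀ = (E * F) i i₀ • (1 : Matrix n n ℝ) := by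
  ext a b
  rw [Matrix.mul_apply, Fintype.sum_prod_type, Matrix.smul_apply, Matrix.mul_apply, Matrix.one_apply,
    smul_eq_mul]
  have h2 : ∀ j : J, (∑ c : n, embed E i a (j, c) * select F i₀ (j, c) b)
      = if a = b then E i j * F j i₀ else 0 := by
    intro j
    simp only [embed_apply, select_apply, ite_mul, zero_mul, mul_ite, mul_zero, Finset.sum_ite_eq',
      Finset.mem_univ, if_true]
  simp only [h2]
  by_cases hab : a = b
  · simp [hab]
  · simp [hab]

/-- **`Q_{i₀}ᵀ G Q_{i₀} = R i₀`** when `E F = 1`: each conjugate block is a congruence image of the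
trace-form block (the trace form diagonalises over the real closure: in the coordinates given by the
inverse embedding matrix it is the direct sum of the conjugates). [cite: Scheiderer2012RationalSOS, §1.1] -/
theorem conjTranspose_select_mul_block_mul_select [Fintype ι] [DecidableEq ι] [Fintype J] [Fintype n]
    [DecidableEq n] (E : Matrix ι J ℝ) (F : Matrix J ι ℝ) (hEF : E * F = 1) (R : ι → Matrix n n ℝ)
    (i₀ : ι) : (select F i₀)ᴴ * block E R * select F i₀ = R i₀ := by
  rw [block_eq_sum_conjTranspose_mul_mul, Matrix.mul_sum, Matrix.sum_mul]
  have h : ∀ i, (select F i₀)ᴴ * ((embed E i)ᴴ * R i * embed E i) * select F i₀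
      = (if i = i₀ then (1 : ℝ) else 0) • R i := by
    intro i
    have hmul : embed E i * select F i₀ = (if i = i₀ then (1 : ℝ) else 0) • (1 : Matrix n n ℝ) := by
      rw [embed_mul_select, hEF, Matrix.one_apply]
    calc (select F i₀)ᴴ * ((embed E i)ᴴ * R i * embed E i) * select F i₀
        = (embed E i * select F i₀)ᴴ * R i * (embed E i * select F i₀) := by
          rw [conjTranspose_mul]
          simp only [Matrix.mul_assoc]
      _ = (if i = i₀ then (1 : ℝ) else 0) • R i := by
          rw [hmul]
          by_cases hi : i = i₀
          · simp [hi]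
          · simp [hi]
  simp only [h]
  rw [Finset.sum_eq_single i₀]
  · simp
  · intro i _ hi
    simp [hi]
  · intro h0
    exact absurd (Finset.mem_univ _) h0

/-- **Tightness direction: nothing is lost.** If `E` has a right inverse (`E F = 1`; for the embedding
matrix `(σ_i(β_j))` of a basis of a number field this is `disc ≠ 0`) and the trace-form block is positive
semidefinite, then every conjugate block is. [cite: Scheiderer2012RationalSOS, §1.1 and Question 5.4] -/
theorem posSemidef_of_block [Fintype ι] [DecidableEq ι] [Fintype J] [Fintype n] [DecidableEq n]
    (E : Matrix ι J ℝ) (F : Matrix J ι ℝ) (hEF : E * F = 1) {R : ι → Matrix n n ℝ}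
    (hG : (block E R).PosSemidef) (i : ι) : (R i).PosSemidef := by
  rw [← conjTranspose_select_mul_block_mul_select E F hEF R i]
  exact hG.conjTranspose_mul_mul_same _

/-- **Trace-form equivalence (restriction of scalars).** With `E F = 1`:
`TraceForm.block E R ⪰ 0 ⟺ ∀ i, R i ⪰ 0`. For a totally real number field `K` with real embeddings
`σ_i`, `ℚ`-basis `β_j`, `E_{ij} = σ_i(β_j)` and `R i = σ_i(R)`: the rational matrix
`[Tr_{K/ℚ}(β_jβ_kR_{ab})]` is positive semidefinite iff `R` is positive semidefinite with respect to
every real place of `K`. [cite: Hillar2009TotallyRealSOS, Theorem 2.1 and Remark 2.2]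
[cite: Scheiderer2012RationalSOS, §1.1 and Question 5.4] -/
theorem posSemidef_block_iff [Fintype ι] [DecidableEq ι] [Fintype J] [Fintype n] [DecidableEq n]
    (E : Matrix ι J ℝ) (F : Matrix J ι ℝ) (hEF : E * F = 1) (R : ι → Matrix n n ℝ) :
    (block E R).PosSemidef ↔ ∀ i, (R i).PosSemidef :=
  ⟨fun hG i => posSemidef_of_block E F hEF hG i, fun hR => posSemidef_block E hR⟩

/-! ## The number-field packaging (soundness direction): for a totally real `K` the block built from
the complex (= real) embeddings IS the rational trace matrix `[Tr_{K/ℚ}(β_j β_k R_{ab})]`. -/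

section NumberField

open NumberField

variable {K : Type*} [Field K] [NumberField K] [IsTotallyReal K]

omit [NumberField K] in
/-- In a totally real field every complex embedding has real values. [folklore] -/
private theorem im_apply_eq_zero (τ : K →+* ℂ) (x : K) : (τ x).im = 0 := by
  rw [← (IsTotallyReal.complexEmbedding_isReal τ).coe_embedding_apply x, Complex.ofReal_im]

omit [IsTotallyReal K] in
/-- `Tr_{K/ℚ}(y) = Σ_τ Re τ(y)` for a number field, read in `ℝ` (Mathlib `trace_eq_sum_embeddings` over
the ring embeddings `K →+* ℂ`; the sum of all embeddings is the rational trace, so taking real parts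
loses nothing — no total reality needed here). [folklore] -/
private theorem ratCast_trace_eq_sum_re (y : K) :
    ((Algebra.trace ℚ K y : ℚ) : ℝ) = ∑ τ : K →+* ℂ, (τ y).re := by
  have hC : ((Algebra.trace ℚ K y : ℚ) : ℂ) = ∑ τ : K →+* ℂ, τ y := by
    rw [← eq_ratCast (algebraMap ℚ ℂ), trace_eq_sum_embeddings ℂ (K := ℚ) (L := K),
      ← Fintype.sum_equiv RingHom.equivRatAlgHom (fun τ : K →+* ℂ => τ y) (fun σ : K →ₐ[ℚ] ℂ => σ y)
        fun τ => rfl]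
  have h := congrArg Complex.re hC
  rw [Complex.re_sum] at h
  rw [← h, ← Complex.ofReal_ratCast, Complex.ofReal_re]

/-- **The trace-form block of the embeddings is the rational trace matrix.** With `ι` = the embeddings
`τ : K →+* ℂ` (all real), `E_{τ j} = τ(β_j)` and conjugate blocks `R τ = τ(R)`:
`(TraceForm.block E R)_{(j,a),(k,b)} = Tr_{K/ℚ}(β_j β_k R_{ab})`.
[cite: Hillar2009TotallyRealSOS, Theorem 2.1 and Remark 2.2] [cite: Scheiderer2012RationalSOS, §1.1] -/
theorem block_embeddings_apply (β : J → K) (R : Matrix n n K) (p q : J × n) :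
    block (Matrix.of fun (τ : K →+* ℂ) (j : J) => (τ (β j)).re) (fun τ => R.map fun x => (τ x).re) p q
      = ((Algebra.trace ℚ K (β p.1 * β q.1 * R p.2 q.2) : ℚ) : ℝ) := by
  rw [block_apply, ratCast_trace_eq_sum_re]
  refine Finset.sum_congr rfl fun τ _ => ?_
  simp only [Matrix.of_apply, Matrix.map_apply, map_mul, Complex.mul_re, im_apply_eq_zero, mul_zero,
    sub_zero]

/-- **Trace-form rationalisation, soundness direction (Hillar 2009 / Scheiderer 2012).** Let `K` be a
totally real number field, `β : J → K` any family (a `ℚ`-basis in the application) and `R` an `n × n`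
matrix over `K`. If `R` is positive semidefinite with respect to EVERY real place of `K` (every embedding
`τ(R) ⪰ 0`), then the RATIONAL matrix `[Tr_{K/ℚ}(β_j β_k R_{ab})]_{(j,a),(k,b)}` is positive semidefinite.
This is the exact inequality a reader certifies in `ℚ` in place of `R ⪰ 0` over `K` (fleet: op-07's
`qtrace` momentum blocks; converse = `posSemidef_of_block` with the inverse of the embedding matrix of a
basis, `disc ≠ 0`). [cite: Hillar2009TotallyRealSOS, Theorem 2.1 and Remark 2.2]
[cite: Scheiderer2012RationalSOS, §1.1 and Question 5.4] -/
theorem posSemidef_traceMatrix_of_forall_embeddings [Fintype J] [Fintype n] [DecidableEq n]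
    (β : J → K) (R : Matrix n n K) (hR : ∀ τ : K →+* ℂ, (R.map fun x => (τ x).re).PosSemidef) :
    (Matrix.of fun p q : J × n =>
      ((Algebra.trace ℚ K (β p.1 * β q.1 * R p.2 q.2) : ℚ) : ℝ)).PosSemidef := by
  have h := posSemidef_block (Matrix.of fun (τ : K →+* ℂ) (j : J) => (τ (β j)).re) hR
  convert h using 1
  ext p q
  rw [Matrix.of_apply, block_embeddings_apply]

end NumberField

/-! ## The number-field packaging, TIGHTNESS direction: for a `ℚ`-BASIS `b` of a totally real `K`
the real embedding matrix `(Re τ(b_j))_{τ,j}` is invertible (its determinant squared is the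
discriminant `discr ℚ b ≠ 0`), so the rational trace matrix is PSD **iff** `R` is PSD with respect
to every real place — Scheiderer's formulation. -/

section NumberFieldTight

open NumberField

variable {K : Type*} [Field K] [NumberField K] [IsTotallyReal K]

omit [NumberField K] in
/-- In a totally real field `((τ x).re : ℂ) = τ x` for every complex embedding. [folklore] -/
private theorem ofReal_re_apply (τ : K →+* ℂ) (x : K) : ((τ x).re : ℂ) = τ x := by
  rw [← (IsTotallyReal.complexEmbedding_isReal τ).coe_embedding_apply x, Complex.ofReal_re]

/-- **The real embedding matrix of a `ℚ`-basis of a totally real field has a right inverse**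
(`E F = 1` with `E_{τ j} = Re τ(b_j)`): after reindexing the embeddings by the basis index, `E`
becomes Mathlib's `embeddingsMatrixReindex` (transposed, read in `ℝ`), whose determinant squares to
`discr ℚ b ≠ 0` (`Algebra.discr_eq_det_embeddingsMatrixReindex_pow_two`,
`Algebra.discr_not_zero_of_basis`). [cite: Scheiderer2012RationalSOS, §1.1] -/
theorem exists_embeddingMatrix_mul_eq_one {J : Type*} [Fintype J] [DecidableEq J]
    [DecidableEq (K →+* ℂ)] (b : Module.Basis J ℚ K) :
    ∃ F : Matrix J (K →+* ℂ) ℝ,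
      (Matrix.of fun (τ : K →+* ℂ) (j : J) => (τ (b j)).re) * F = 1 := by
  classical
  have hcard : Fintype.card (K →+* ℂ) = Fintype.card J := by
    rw [NumberField.Embeddings.card, Module.finrank_eq_card_basis b]
  let e : (K →+* ℂ) ≃ J := Fintype.equivOfCardEq hcard
  set E : Matrix (K →+* ℂ) J ℝ := Matrix.of fun (τ : K →+* ℂ) (j : J) => (τ (b j)).re with hE
  -- the square version, rows indexed by `J` through `e`
  let E' : Matrix J J ℝ := E.submatrix e.symm id
  -- Mathlib's embeddings matrix, indexed by `J` through `e` and the `ℚ`-algebra-hom identification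
  let e' : J ≃ (K →ₐ[ℚ] ℂ) := e.symm.trans RingHom.equivRatAlgHom
  have hmat : Algebra.embeddingsMatrixReindex ℚ ℂ (⇑b) e' = (E'.map Complex.ofReal)ᵀ := by
    ext i j
    simp only [Algebra.embeddingsMatrixReindex, Matrix.reindex_apply, Matrix.submatrix_apply,
      Equiv.refl_symm, Equiv.refl_apply, Equiv.symm_symm, Algebra.embeddingsMatrix_apply,
      Matrix.transpose_apply, Matrix.map_apply, E', hE, Matrix.of_apply, id_eq, e',
      Equiv.trans_apply, RingHom.equivRatAlgHom, Equiv.coe_fn_mk, RingHom.toRatAlgHom_apply,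
      ofReal_re_apply]
  have hdet : E'.det ≠ 0 := by
    intro h0
    have h1 := Algebra.discr_eq_det_embeddingsMatrixReindex_pow_two ℚ ℂ (⇑b) e'
    rw [hmat, Matrix.det_transpose, ← Complex.coe_algebraMap, ← RingHom.mapMatrix_apply,
      ← RingHom.map_det, h0, map_zero, zero_pow two_ne_zero, map_eq_zero_iff _
      (algebraMap ℚ ℂ).injective] at h1
    exact Algebra.discr_not_zero_of_basis ℚ b h1
  have hunit : IsUnit E'.det := isUnit_iff_ne_zero.mpr hdet
  refine ⟨Matrix.of fun j τ => (E'⁻¹) j (e τ), ?_⟩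
  have hinv := Matrix.mul_nonsing_inv E' hunit
  ext τ τ'
  have h := congrFun (congrFun hinv (e τ)) (e τ')
  rw [Matrix.mul_apply] at h
  rw [Matrix.mul_apply, Matrix.one_apply]
  simp only [E', Matrix.submatrix_apply, Equiv.symm_apply_apply, id_eq, Matrix.one_apply,
    EmbeddingLike.apply_eq_iff_eq] at h
  simpa only [Matrix.of_apply] using h

/-- **Trace-form rationalisation, the EQUIVALENCE (Scheiderer 2012, 'positive semidefinite with
respect to every real place').** For a totally real number field `K`, a `ℚ`-BASIS `b : J → K` and an
`n × n` matrix `R` over `K`: the rational matrix `[Tr_{K/ℚ}(b_j b_k R_{ab})]_{(j,a),(k,b)}` is positive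
semidefinite **iff** `τ(R) ⪰ 0` for every embedding `τ` — soundness is
`posSemidef_traceMatrix_of_forall_embeddings` (any family `b`), tightness needs `b` a basis
(`exists_embeddingMatrix_mul_eq_one`). [cite: Scheiderer2012RationalSOS, §1.1 and Question 5.4]
[cite: Hillar2009TotallyRealSOS, Theorem 2.1 and Remark 2.2] -/
theorem posSemidef_traceMatrix_iff {J n : Type*} [Fintype J] [DecidableEq J] [Fintype n]
    [DecidableEq n] [DecidableEq (K →+* ℂ)] (b : Module.Basis J ℚ K) (R : Matrix n n K) :
    (Matrix.of fun p q : J × n =>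
      ((Algebra.trace ℚ K (b p.1 * b q.1 * R p.2 q.2) : ℚ) : ℝ)).PosSemidef ↔
      ∀ τ : K →+* ℂ, (R.map fun x => (τ x).re).PosSemidef := by
  have hblock : (Matrix.of fun p q : J × n =>
      ((Algebra.trace ℚ K (b p.1 * b q.1 * R p.2 q.2) : ℚ) : ℝ)) =
      block (Matrix.of fun (τ : K →+* ℂ) (j : J) => (τ (b j)).re) (fun τ => R.map fun x => (τ x).re) := by
    ext p q
    rw [Matrix.of_apply, block_embeddings_apply]
  rw [hblock]
  obtain ⟨F, hF⟩ := exists_embeddingMatrix_mul_eq_one (K := K) b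
  exact posSemidef_block_iff _ F hF _

end NumberFieldTight

end TraceForm

end Literature.Computation.Certificates
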